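import Literature.Probability.Percolation.BernoulliPercolation
import Literature.Probability.Percolation.InsertionTolerance
import Literature.Probability.Percolation.SecondMomentMethod
import Mathlib.Algebra.Ring.GeomSum
import Mathlib.Algebra.Field.GeomSum
import HarnessLib

/-!
# `p_c(ℤ^d) ≤ ρ_d`: the Cox–Durrett oriented-path bound for bond percolation

Topic `Literature/Probability/Percolation`.  Sorry-free, no named facts.  This is the upper bound
on the critical probability used in the proof of Bock–Damron–Newman–Sidoravicius,
*Percolation of finite clusters and shielded paths*, J. Stat. Phys. 179 (2020), Corollary 1.5
(`p_c(d) < p_shield(d) ≤ p_fin(d)` for `d ≥ 10`), §4 p. 10: "we use [Cox–Durrett 1983], which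
states that the oriented threshold satisfies `p⃗_c(d) ≤ ρ_d`.  Since `p_c(d) ≤ p⃗_c(d)`, we obtain
`p_c(d) ≤ ρ_d`", where `ρ_d = P(S_k = S'_k, S_{k+1} = S'_{k+1} for some k ≥ 0)` is the probability
that two independent uniform ORIENTED walks from the origin (steps `+e_1, …, +e_d`) ever share a
step (J. T. Cox, R. Durrett, *Oriented percolation in dimensions d ≥ 4: bounds and asymptotic
formulas*, Math. Proc. Cambridge Philos. Soc. 93 (1983) 151–162, §1 and (3.1)–(3.3): the
second-moment method for the number `N_n` of open oriented paths of length `n`).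

## Contents (finite, combinatorial version of the Cox–Durrett argument)

* Oriented words `w : Fin n → Fin d`, their positions `opos w k = e_{w 0} + ⋯ + e_{w (k-1)}`, levels
  (`level (opos w k) = k`), the `n` (distinct) edges `oedges w` of the oriented path of `w`, and
  `meetCount z w w'` = the number of steps `k` at which the path of `w` translated by `-z` and the
  path of `w'` traverse the same edge (`z = 0`: the number of common edges,
  `card (oedges w ∩ oedges w') = meetCount 0 w w'`).
* `meetPairs d n` = the number of pairs of words of length `n` sharing at least one edge, and the
  finite-`n` meeting probabilities `meetPairs d n / d^{2n} ↑ ρ_d`.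
* RENEWAL (`pairsGe_le`): `#{(w,w') : meetCount 0 w w' ≥ j} ≤ ρ^j d^{2n}` whenever
  `meetPairs d m ≤ ρ d^{2m}` for all `m` (first-step decomposition with an offset `z`, the finite
  form of "the number of common edges is geometric with parameter `ρ_d`", Cox–Durrett §3).
* Abel summation (`sum_pow_meetCount_le`): `Σ_{w,w'} p^{-#common} ≤ d^{2n} p(1-ρ)/(p-ρ)`.
* SECOND MOMENT (`real_someOpenOriented_ge`): with `A_w = {all edges of w open}`,
  `P_p(A_w) = p^n`, `P_p(A_w ∩ A_w') = p^{2n - meetCount 0 w w'}`, the Chung–Erdős / Paley–Zygmund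
  bound of `SecondMomentMethod.lean` gives
  `P_p(some open oriented path of length n from 0) ≥ (p - ρ)/(p (1 - ρ))` for `ρ < p`.
* `theta_zd_ge_of_meetPairs_le`, **`criticalProb_zd_le_of_meetPairs_le`**: the events decrease in
  `n`, their intersection forces `|C(0)| = ∞` (open vertices at every level), so by continuity
  from above `θ_0(p) ≥ (p - ρ)/(p(1 - ρ)) > 0` for `p > ρ`, whence `p_c(ℤ^d) ≤ ρ`.

The explicit estimate `ρ_d ≤ g(d)` ((4.11) of BDNS 2020) is NOT in this file.

## References

* J. T. Cox, R. Durrett, *Oriented percolation in dimensions `d ≥ 4`: bounds and asymptotic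
  formulas*, Math. Proc. Cambridge Philos. Soc. 93 (1983) 151–162. [CoxDurrett1983]
* B. Bock, M. Damron, C. M. Newman, V. Sidoravicius, *Percolation of finite clusters and shielded
  paths*, J. Stat. Phys. 179 (2020) 789–807, arXiv:1811.01678, §4. [BockEtAl2020]
* R. Lyons, Y. Peres, *Probability on Trees and Networks*, CUP 2016, §5.3 (second moment).
-/

noncomputable section

namespace Literature.Probability.Percolation

open MeasureTheory Finset Literature.Probability.LatticeModels
open scoped ENNReal

variable {d : ℕ}

/-! ### Oriented words, positions, levels -/

/-- The position after the first `k` steps of the oriented word `w` (step `i` is `+e_{w i}`);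
constant (the endpoint) for `k ≥ n`. [cite: CoxDurrett1983, §1] -/
def opos {n : ℕ} (w : Fin n → Fin d) (k : ℕ) : Site d :=
  ∑ i : Fin n, if (i : ℕ) < k then Pi.single (w i) 1 else 0

/-- The level (sum of coordinates) of a site. [folklore] -/
def level (x : Site d) : ℤ := ∑ i, x i

/-- The origin has level `0`. [folklore] -/
@[simp] theorem level_zero : level (0 : Site d) = 0 := by simp [level]

/-- `level` is additive. [folklore] -/
theorem level_add (x y : Site d) : level (x + y) = level x + level y := by
  simp [level, Finset.sum_add_distrib]

/-- `level` of a difference. [folklore] -/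
theorem level_sub (x y : Site d) : level (x - y) = level x - level y := by
  simp [level, Finset.sum_sub_distrib]

/-- A unit coordinate vector has level `1`. [folklore] -/
@[simp] theorem level_single (a : Fin d) : level (Pi.single a (1 : ℤ) : Site d) = 1 := by
  simp [level]

/-- The oriented path starts at the origin. [folklore] -/
@[simp] theorem opos_zero {n : ℕ} (w : Fin n → Fin d) : opos w 0 = 0 := by
  simp [opos]

/-- One more step. [cite: CoxDurrett1983, §1] -/
theorem opos_succ {n : ℕ} (w : Fin n → Fin d) {k : ℕ} (hk : k < n) :
    opos w (k + 1) = opos w k + Pi.single (w ⟨k, hk⟩) 1 := by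
  have h : ∀ i : Fin n, (if (i : ℕ) < k + 1 then (Pi.single (w i) 1 : Site d) else 0) =
      (if (i : ℕ) < k then (Pi.single (w i) 1 : Site d) else 0) +
        (if i = ⟨k, hk⟩ then Pi.single (w i) 1 else 0) := by
    intro i
    by_cases h1 : (i : ℕ) < k
    · have hne : i ≠ ⟨k, hk⟩ := by
        rintro rfl
        exact lt_irrefl _ h1
      simp [h1, Nat.lt_succ_of_lt h1, hne]
    · by_cases h2 : i = ⟨k, hk⟩
      · subst h2
        simp
      · have h3 : ¬ (i : ℕ) < k + 1 := by
          intro h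
          rcases Nat.lt_succ_iff_lt_or_eq.1 h with h | h
          · exact h1 h
          · exact h2 (Fin.ext h)
        simp [h1, h2, h3]
  simp only [opos]
  rw [Finset.sum_congr rfl fun i _ => h i, Finset.sum_add_distrib, Finset.sum_ite_eq']
  simp

/-- After the word is exhausted the position is constant. [folklore] -/
theorem opos_of_le {n : ℕ} (w : Fin n → Fin d) {k : ℕ} (hk : n ≤ k) : opos w k = opos w n := by
  simp only [opos]
  refine Finset.sum_congr rfl fun i _ => ?_
  simp [i.2, lt_of_lt_of_le i.2 hk]

/-- `level (opos w k) = k` for `k ≤ n`. [cite: CoxDurrett1983, §1] -/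
theorem level_opos {n : ℕ} (w : Fin n → Fin d) {k : ℕ} (hk : k ≤ n) : level (opos w k) = k := by
  induction k with
  | zero => simp
  | succ k ih =>
    rw [opos_succ w hk, level_add, ih (Nat.le_of_succ_le hk), level_single]
    push_cast
    ring

/-- Positions along an oriented path are pairwise distinct. [folklore] -/
theorem opos_injOn {n : ℕ} (w : Fin n → Fin d) {k l : ℕ} (hk : k ≤ n) (hl : l ≤ n)
    (h : opos w k = opos w l) : k = l := by
  have := congrArg level h
  rw [level_opos w hk, level_opos w hl] at this
  exact_mod_cast this

/-- The first step of `Fin.cons a v` followed by `k` steps of `v`. [folklore] -/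
theorem opos_cons_succ {n : ℕ} (a : Fin d) (v : Fin n → Fin d) (k : ℕ) :
    opos (Fin.cons a v : Fin (n + 1) → Fin d) (k + 1) = Pi.single a 1 + opos v k := by
  simp only [opos, Fin.sum_univ_succ, Fin.cons_zero, Fin.cons_succ, Fin.val_zero,
    Nat.zero_lt_succ, if_true, Fin.val_succ, Nat.succ_lt_succ_iff]

/-- Dropping the last letter does not change the first `k ≤ n` positions. [folklore] -/
theorem opos_init {n : ℕ} (w : Fin (n + 1) → Fin d) {k : ℕ} (hk : k ≤ n) :
    opos (Fin.init w) k = opos w k := by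
  induction k with
  | zero => simp
  | succ k ih =>
    rw [opos_succ _ hk, opos_succ w (Nat.lt_succ_of_lt hk), ih (Nat.le_of_succ_le hk)]
    rfl

/-! ### The edges of an oriented path -/

/-- The `k`-th edge of the oriented path of `w`. [cite: CoxDurrett1983, §1] -/
def oedge {n : ℕ} (w : Fin n → Fin d) (k : Fin n) : Sym2 (Site d) :=
  s(opos w k, opos w (k + 1))

/-- The set of edges of the oriented path of `w`. [cite: CoxDurrett1983, §1] -/
def oedges {n : ℕ} (w : Fin n → Fin d) : Finset (Sym2 (Site d)) :=
  univ.image (oedge w)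

/-- The edges of an oriented path are edges of `𝕃^d`. [folklore] -/
theorem oedge_mem_edgeSet {n : ℕ} (w : Fin n → Fin d) (k : Fin n) :
    oedge w k ∈ (zdGraph d).edgeSet := by
  rw [oedge, SimpleGraph.mem_edgeSet, zdGraph_adj_iff]
  exact ⟨w k, Or.inl (opos_succ w k.2)⟩

/-- The edge set of an oriented path lies in `E(𝕃^d)`. [folklore] -/
theorem coe_oedges_subset_edgeSet {n : ℕ} (w : Fin n → Fin d) :
    (↑(oedges w) : Set (Sym2 (Site d))) ⊆ (zdGraph d).edgeSet := by
  intro e he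
  obtain ⟨k, -, rfl⟩ := Finset.mem_image.1 (Finset.mem_coe.1 he)
  exact oedge_mem_edgeSet w k

/-- Two oriented paths share the edge with indices `k`, `k'` iff `k = k'`, the paths are at the same
site after `k` steps and take the same `k`-th step. [cite: CoxDurrett1983, §3] -/
theorem oedge_eq_oedge_iff {n : ℕ} {w w' : Fin n → Fin d} {k k' : Fin n} :
    oedge w k = oedge w' k' ↔ (k : ℕ) = k' ∧ opos w k = opos w' k ∧ w k = w' k := by
  constructor
  · intro h
    rw [oedge, oedge, Sym2.eq_iff] at h
    rcases h with ⟨h1, h2⟩ | ⟨h1, h2⟩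
    · have hk : (k : ℕ) = k' := by
        have := congrArg level h1
        rw [level_opos w (Nat.le_of_lt k.2), level_opos w' (Nat.le_of_lt k'.2)] at this
        exact_mod_cast this
      have hkk : k = k' := Fin.ext hk
      subst hkk
      refine ⟨rfl, h1, ?_⟩
      rw [opos_succ w k.2, opos_succ w' k.2, h1, add_right_inj] at h2
      have := congrFun h2 (w k)
      simp only [Pi.single_eq_same] at this
      by_contra hne
      rw [Pi.single_eq_of_ne hne] at this
      exact one_ne_zero this
    · exfalso
      have e1 := congrArg level h1
      have e2 := congrArg level h2
      rw [level_opos w (Nat.le_of_lt k.2), level_opos w' k'.2] at e1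
      rw [level_opos w k.2, level_opos w' (Nat.le_of_lt k'.2)] at e2
      push_cast at e1 e2
      linarith
  · rintro ⟨hk, hpos, hstep⟩
    have hkk : k = k' := Fin.ext hk
    subst hkk
    rw [oedge, oedge, opos_succ w k.2, opos_succ w' k.2, hpos, hstep]

/-- Distinct steps traverse distinct edges. [folklore] -/
theorem oedge_injective {n : ℕ} (w : Fin n → Fin d) : Function.Injective (oedge w) :=
  fun _ _ h => Fin.ext (oedge_eq_oedge_iff.1 h).1

/-- An oriented path of length `n` has exactly `n` edges. [cite: CoxDurrett1983, §1] -/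
theorem card_oedges {n : ℕ} (w : Fin n → Fin d) : (oedges w).card = n := by
  rw [oedges, Finset.card_image_of_injective _ (oedge_injective w), Finset.card_univ,
    Fintype.card_fin]

/-! ### Common edges -/

/-- The steps `k` at which `opos w' k - opos w k = z` and the `k`-th letters agree; for `z = 0`
these index the common edges of the two oriented paths. [cite: CoxDurrett1983, §3] -/
def meetIdx {n : ℕ} (z : Site d) (w w' : Fin n → Fin d) : Finset (Fin n) :=
  univ.filter fun k => opos w' k - opos w k = z ∧ w k = w' k

/-- The number of such steps (`z = 0`: the number of common edges). [cite: CoxDurrett1983, §3] -/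
def meetCount {n : ℕ} (z : Site d) (w w' : Fin n → Fin d) : ℕ :=
  (meetIdx z w w').card

/-- At most `n` common steps. [folklore] -/
theorem meetCount_le {n : ℕ} (z : Site d) (w w' : Fin n → Fin d) : meetCount z w w' ≤ n := by
  unfold meetCount meetIdx
  exact (Finset.card_filter_le _ _).trans (by simp)

/-- The common edges are the edges at the common steps. [cite: CoxDurrett1983, §3] -/
theorem oedges_inter_eq {n : ℕ} (w w' : Fin n → Fin d) :
    oedges w ∩ oedges w' = (meetIdx 0 w w').image (oedge w) := by
  ext e
  simp only [oedges, Finset.mem_inter, Finset.mem_image, Finset.mem_univ, true_and, meetIdx,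
    Finset.mem_filter, sub_eq_zero]
  constructor
  · rintro ⟨⟨k, rfl⟩, ⟨k', hk'⟩⟩
    obtain ⟨hkk, hpos, hstep⟩ := oedge_eq_oedge_iff.1 hk'
    have : k' = k := Fin.ext hkk
    subst this
    exact ⟨k', ⟨hpos, hstep.symm⟩, rfl⟩
  · rintro ⟨k, ⟨hpos, hstep⟩, rfl⟩
    exact ⟨⟨k, rfl⟩, ⟨k, oedge_eq_oedge_iff.2 ⟨rfl, hpos, hstep.symm⟩⟩⟩

/-- `|E(w) ∩ E(w')| =` the number of common edges. [cite: CoxDurrett1983, §3] -/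
theorem card_oedges_inter {n : ℕ} (w w' : Fin n → Fin d) :
    (oedges w ∩ oedges w').card = meetCount 0 w w' := by
  rw [oedges_inter_eq, Finset.card_image_of_injective _ (oedge_injective w), meetCount]

/-- `|E(w) ∪ E(w')| + #common = 2n`. [cite: CoxDurrett1983, §3] -/
theorem card_oedges_union_add {n : ℕ} (w w' : Fin n → Fin d) :
    (oedges w ∪ oedges w').card + meetCount 0 w w' = 2 * n := by
  rw [← card_oedges_inter, Finset.card_union_add_card_inter, card_oedges, card_oedges, two_mul]

/-- First-step decomposition of the meeting count: for words `a :: v`, `a' :: v'`, step `0` is a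
common (offset-`z`) step iff `z = 0` and `a = a'`, and the later ones are those of `v, v'` with the
offset moved to `z + e_a - e_{a'}`. [cite: CoxDurrett1983, §3] -/
theorem meetCount_cons {n : ℕ} (z : Site d) (a a' : Fin d) (v v' : Fin n → Fin d) :
    meetCount z (Fin.cons a v : Fin (n + 1) → Fin d) (Fin.cons a' v') =
      (if z = 0 ∧ a = a' then 1 else 0) +
        meetCount (z + Pi.single a 1 - Pi.single a' 1) v v' := by
  classical
  simp only [meetCount, meetIdx, Finset.card_filter, Fin.sum_univ_succ, Fin.cons_zero,
    Fin.cons_succ, Fin.val_zero, opos_zero, sub_zero, Fin.val_succ, opos_cons_succ]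
  congr 1
  · by_cases h : z = 0 ∧ a = a'
    · rw [if_pos h, if_pos ⟨h.1.symm, h.2⟩]
    · rw [if_neg h, if_neg fun h' => h ⟨h'.1.symm, h'.2⟩]
  · refine Finset.sum_congr rfl fun i _ => ?_
    have : (Pi.single a' 1 + opos v' i - (Pi.single a 1 + opos v i) = z) ↔
        (opos v' i - opos v i = z + Pi.single a 1 - Pi.single a' 1) := by
      constructor <;> intro h <;> linear_combination h
    simp only [this]

/-! ### Counting pairs of words -/

/-- The number of pairs of words of length `n` with at least `j` offset-`z` common steps.
[cite: CoxDurrett1983, §3] -/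
def pairsGe (d n : ℕ) (z : Site d) (j : ℕ) : ℝ :=
  ∑ w : Fin n → Fin d, ∑ w' : Fin n → Fin d, if j ≤ meetCount z w w' then 1 else 0

/-- The number of pairs of oriented words of length `n` whose paths share an edge; divided by
`d^{2n}` this is `P(S_k = S'_k, S_{k+1} = S'_{k+1} for some k < n) ↑ ρ_d`. [cite: CoxDurrett1983, §1] -/
def meetPairs (d n : ℕ) : ℝ := pairsGe d n 0 1

/-- Counts are nonnegative. [folklore] -/
theorem pairsGe_nonneg (d n : ℕ) (z : Site d) (j : ℕ) : 0 ≤ pairsGe d n z j :=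
  Finset.sum_nonneg fun _ _ => Finset.sum_nonneg fun _ _ => by positivity

/-- Counts are nonnegative. [folklore] -/
theorem meetPairs_nonneg (d n : ℕ) : 0 ≤ meetPairs d n := pairsGe_nonneg d n 0 1

/-- With no constraint all `d^n · d^n` pairs count. [folklore] -/
theorem pairsGe_zero_right (d n : ℕ) (z : Site d) : pairsGe d n z 0 = (d : ℝ) ^ (2 * n) := by
  simp only [pairsGe, zero_le, if_true, Finset.sum_const, Finset.card_univ, Fintype.card_fun,
    Fintype.card_fin, nsmul_eq_mul, mul_one]
  push_cast
  ring

/-- At most `d^{2n}` pairs. [folklore] -/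
theorem pairsGe_le_sq (d n : ℕ) (z : Site d) (j : ℕ) : pairsGe d n z j ≤ (d : ℝ) ^ (2 * n) := by
  calc pairsGe d n z j ≤ ∑ w : Fin n → Fin d, ∑ w' : Fin n → Fin d, (1 : ℝ) :=
        Finset.sum_le_sum fun w _ => Finset.sum_le_sum fun w' _ => by split_ifs <;> norm_num
    _ = pairsGe d n z 0 := by simp [pairsGe]
    _ = (d : ℝ) ^ (2 * n) := pairsGe_zero_right d n z

/-- At most `d^{2n}` meeting pairs (the meeting probability is `≤ 1`). [folklore] -/
theorem meetPairs_le (d n : ℕ) : meetPairs d n ≤ (d : ℝ) ^ (2 * n) := pairsGe_le_sq d n 0 1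

/-- Words of length `0` never meet. [folklore] -/
theorem pairsGe_length_zero (d : ℕ) (z : Site d) (j : ℕ) : pairsGe d 0 z (j + 1) = 0 := by
  refine Finset.sum_eq_zero fun w _ => Finset.sum_eq_zero fun w' _ => ?_
  have : meetCount z w w' = 0 := Nat.eq_zero_of_le_zero (meetCount_le z w w')
  simp [this]

/-- Summing over words of length `n + 1` = summing over the first letter and the tail. [folklore] -/
theorem sum_word_succ {M : Type*} [AddCommMonoid M] (n : ℕ) (f : (Fin (n + 1) → Fin d) → M) :
    ∑ w, f w = ∑ a : Fin d, ∑ v : Fin n → Fin d, f (Fin.cons a v) := by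
  rw [← Fintype.sum_prod_type']
  exact Fintype.sum_equiv (Fin.consEquiv fun _ => Fin d).symm _ _ fun w => by
    simp [Fin.consEquiv, Fin.cons_self_tail]

/-- Summing over PAIRS of words of length `n + 1`. [folklore] -/
theorem sum_wordPair_succ (n : ℕ) (g : (Fin (n + 1) → Fin d) → (Fin (n + 1) → Fin d) → ℝ) :
    ∑ w, ∑ w', g w w' =
      ∑ a : Fin d, ∑ a' : Fin d, ∑ v : Fin n → Fin d, ∑ v' : Fin n → Fin d,
        g (Fin.cons a v) (Fin.cons a' v') := by
  rw [sum_word_succ]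
  refine Finset.sum_congr rfl fun a _ => ?_
  have : ∀ v : Fin n → Fin d, ∑ w', g (Fin.cons a v) w' =
      ∑ a' : Fin d, ∑ v' : Fin n → Fin d, g (Fin.cons a v) (Fin.cons a' v') :=
    fun v => sum_word_succ n _
  simp_rw [this]
  exact Finset.sum_comm

/-- First-step decomposition of `pairsGe`. [cite: CoxDurrett1983, §3] -/
theorem pairsGe_succ (d n : ℕ) (z : Site d) (j : ℕ) :
    pairsGe d (n + 1) z (j + 1) = ∑ a : Fin d, ∑ a' : Fin d,
      if z = 0 ∧ a = a' then pairsGe d n 0 j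
      else pairsGe d n (z + Pi.single a 1 - Pi.single a' 1) (j + 1) := by
  simp only [pairsGe]
  rw [sum_wordPair_succ]
  refine Finset.sum_congr rfl fun a _ => Finset.sum_congr rfl fun a' _ => ?_
  by_cases h : z = 0 ∧ a = a'
  · rw [if_pos h]
    refine Finset.sum_congr rfl fun v _ => Finset.sum_congr rfl fun v' _ => ?_
    rw [meetCount_cons, if_pos h, h.1, h.2, zero_add, sub_self]
    simp [add_comm 1]
  · rw [if_neg h]
    refine Finset.sum_congr rfl fun v _ => Finset.sum_congr rfl fun v' _ => ?_
    rw [meetCount_cons, if_neg h, zero_add]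

/-- The same decomposition for `meetPairs`-type counts (`j = 0` in the tail when the first steps
agree: then every continuation counts). [cite: CoxDurrett1983, §3] -/
theorem pairsGe_succ_one (d n : ℕ) (z : Site d) :
    pairsGe d (n + 1) z 1 = ∑ a : Fin d, ∑ a' : Fin d,
      if z = 0 ∧ a = a' then (d : ℝ) ^ (2 * n)
      else pairsGe d n (z + Pi.single a 1 - Pi.single a' 1) 1 := by
  rw [pairsGe_succ]
  refine Finset.sum_congr rfl fun a _ => Finset.sum_congr rfl fun a' _ => ?_
  split_ifs
  · exact pairsGe_zero_right d n 0
  · rfl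

/-- **Renewal bound** (finite form of Cox–Durrett's "the number of common edges of two independent
oriented walks is geometric with parameter `ρ_d`"): if `meetPairs d m ≤ ρ d^{2m}` for all `m`,
then for every offset `z`, `#{≥ j+1 common steps} ≤ #{≥ 1 common step} · ρ^j`.
[cite: CoxDurrett1983, §3 (3.2)–(3.3)] -/
theorem pairsGe_succ_le {ρ : ℝ} (hρ0 : 0 ≤ ρ) (hρ : ∀ m, meetPairs d m ≤ ρ * (d : ℝ) ^ (2 * m))
    (n : ℕ) (z : Site d) (j : ℕ) : pairsGe d n z (j + 1) ≤ pairsGe d n z 1 * ρ ^ j := by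
  induction n generalizing z j with
  | zero =>
    rw [pairsGe_length_zero]
    exact mul_nonneg (pairsGe_nonneg _ _ _ _) (pow_nonneg hρ0 _)
  | succ n ih =>
    rw [pairsGe_succ, pairsGe_succ_one, Finset.sum_mul]
    refine Finset.sum_le_sum fun a _ => ?_
    rw [Finset.sum_mul]
    refine Finset.sum_le_sum fun a' _ => ?_
    split_ifs with h
    · -- first steps coincide: need `pairsGe d n 0 j ≤ d^{2n} ρ^j`
      cases j with
      | zero => rw [pairsGe_zero_right, pow_zero, mul_one]
      | succ j =>
        calc pairsGe d n 0 (j + 1) ≤ pairsGe d n 0 1 * ρ ^ j := ih 0 j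
          _ ≤ ρ * (d : ℝ) ^ (2 * n) * ρ ^ j :=
            mul_le_mul_of_nonneg_right (hρ n) (pow_nonneg hρ0 _)
          _ = (d : ℝ) ^ (2 * n) * ρ ^ (j + 1) := by ring
    · exact ih _ j

/-- Consequently `#{(w,w') : ≥ j common edges} ≤ ρ^j d^{2n}`. [cite: CoxDurrett1983, §3] -/
theorem pairsGe_le {ρ : ℝ} (hρ0 : 0 ≤ ρ) (hρ : ∀ m, meetPairs d m ≤ ρ * (d : ℝ) ^ (2 * m))
    (n j : ℕ) : pairsGe d n 0 j ≤ ρ ^ j * (d : ℝ) ^ (2 * n) := by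
  cases j with
  | zero => rw [pairsGe_zero_right, pow_zero, one_mul]
  | succ j =>
    calc pairsGe d n 0 (j + 1) ≤ pairsGe d n 0 1 * ρ ^ j := pairsGe_succ_le hρ0 hρ n 0 j
      _ ≤ ρ * (d : ℝ) ^ (2 * n) * ρ ^ j := mul_le_mul_of_nonneg_right (hρ n) (pow_nonneg hρ0 _)
      _ = ρ ^ (j + 1) * (d : ℝ) ^ (2 * n) := by ring

/-! ### Abel summation: `Σ_{w,w'} x^{#common} ≤ d^{2n} · p(1-ρ)/(p-ρ)` for `x = 1/p` -/

/-- Moving the innermost of three sums to the outside. [folklore] -/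
theorem sum_sum_sum_comm {α β γ M : Type*} [AddCommMonoid M] (s : Finset α) (t : Finset β)
    (u : Finset γ) (f : α → β → γ → M) :
    ∑ a ∈ s, ∑ b ∈ t, ∑ c ∈ u, f a b c = ∑ c ∈ u, ∑ a ∈ s, ∑ b ∈ t, f a b c := by
  calc ∑ a ∈ s, ∑ b ∈ t, ∑ c ∈ u, f a b c = ∑ a ∈ s, ∑ c ∈ u, ∑ b ∈ t, f a b c :=
        Finset.sum_congr rfl fun a _ => Finset.sum_comm
    _ = ∑ c ∈ u, ∑ a ∈ s, ∑ b ∈ t, f a b c := Finset.sum_comm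

/-- `x^m = 1 + (x - 1) Σ_{j<n} x^j 1[j < m]` for `m ≤ n`. [folklore] -/
theorem pow_eq_one_add_sum_indicator (x : ℝ) {m n : ℕ} (hm : m ≤ n) :
    x ^ m = 1 + (x - 1) * ∑ j ∈ range n, (if j + 1 ≤ m then x ^ j else 0) := by
  have h1 : ∑ j ∈ range n, (if j + 1 ≤ m then x ^ j else 0) = ∑ j ∈ range m, x ^ j := by
    rw [← Finset.sum_filter]
    congr 1
    ext j
    simp only [Finset.mem_filter, Finset.mem_range]
    omega
  rw [h1, mul_comm, geom_sum_mul]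
  ring

/-- **Abel summation of the pair sum.** [cite: CoxDurrett1983, §3 (3.3)] -/
theorem sum_pow_meetCount_le {ρ : ℝ} (hρ0 : 0 ≤ ρ)
    (hρ : ∀ m, meetPairs d m ≤ ρ * (d : ℝ) ^ (2 * m)) {p : ℝ} (hρp : ρ < p) (hp1 : p ≤ 1) (n : ℕ) :
    ∑ w : Fin n → Fin d, ∑ w' : Fin n → Fin d, p⁻¹ ^ meetCount 0 w w' ≤
      (d : ℝ) ^ (2 * n) * (p * (1 - ρ) / (p - ρ)) := by
  have hp0 : 0 < p := hρ0.trans_lt hρp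
  set x : ℝ := p⁻¹ with hx
  have hx1 : 1 ≤ x := by rw [hx]; exact one_le_inv_iff₀.2 ⟨hp0, hp1⟩
  have hx0 : 0 ≤ x := zero_le_one.trans hx1
  have hxρ : x * ρ < 1 := by
    have h := mul_lt_mul_of_pos_left hρp (inv_pos.2 hp0)
    rwa [inv_mul_cancel₀ hp0.ne'] at h
  have hxρ0 : 0 ≤ x * ρ := mul_nonneg hx0 hρ0
  -- rewrite each power by Abel summation and exchange sums
  have hrw : ∀ w w' : Fin n → Fin d, x ^ meetCount 0 w w' =
      1 + (x - 1) * ∑ j ∈ range n, x ^ j * (if j + 1 ≤ meetCount 0 w w' then 1 else 0) := by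
    intro w w'
    rw [pow_eq_one_add_sum_indicator x (meetCount_le 0 w w')]
    simp only [mul_ite, mul_one, mul_zero]
  have h1 : ∑ w : Fin n → Fin d, ∑ w' : Fin n → Fin d, (1 : ℝ) = (d : ℝ) ^ (2 * n) := by
    rw [← pairsGe_zero_right d n 0]; simp [pairsGe]
  have h2 : ∑ w : Fin n → Fin d, ∑ w' : Fin n → Fin d,
      (x - 1) * ∑ j ∈ range n, x ^ j * (if j + 1 ≤ meetCount 0 w w' then (1 : ℝ) else 0) =
      (x - 1) * ∑ j ∈ range n, x ^ j * pairsGe d n 0 (j + 1) := by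
    simp_rw [← Finset.mul_sum]
    congr 1
    rw [sum_sum_sum_comm]
    refine Finset.sum_congr rfl fun j _ => ?_
    rw [pairsGe, Finset.mul_sum]
    refine Finset.sum_congr rfl fun w _ => ?_
    rw [Finset.mul_sum]
  have hstep : ∑ w : Fin n → Fin d, ∑ w' : Fin n → Fin d, x ^ meetCount 0 w w' =
      (d : ℝ) ^ (2 * n) + (x - 1) * ∑ j ∈ range n, x ^ j * pairsGe d n 0 (j + 1) := by
    calc ∑ w : Fin n → Fin d, ∑ w' : Fin n → Fin d, x ^ meetCount 0 w w'
        = ∑ w : Fin n → Fin d, ∑ w' : Fin n → Fin d,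
            ((1 : ℝ) + (x - 1) * ∑ j ∈ range n,
              x ^ j * (if j + 1 ≤ meetCount 0 w w' then 1 else 0)) :=
          Finset.sum_congr rfl fun w _ => Finset.sum_congr rfl fun w' _ => hrw w w'
      _ = ∑ w : Fin n → Fin d, ∑ w' : Fin n → Fin d, (1 : ℝ) +
          ∑ w : Fin n → Fin d, ∑ w' : Fin n → Fin d,
            (x - 1) * ∑ j ∈ range n, x ^ j * (if j + 1 ≤ meetCount 0 w w' then 1 else 0) := by
          rw [← Finset.sum_add_distrib]
          exact Finset.sum_congr rfl fun w _ => Finset.sum_add_distrib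
      _ = _ := by rw [h1, h2]
  rw [hstep]
  -- bound the pair counts by the renewal estimate and sum the geometric series
  have hgeom : ∑ j ∈ range n, (x * ρ) ^ j ≤ 1 / (1 - x * ρ) := by
    rw [geom_sum_eq hxρ.ne n, le_div_iff₀ (sub_pos.2 hxρ), div_mul_eq_mul_div,
      div_le_iff_of_neg (sub_neg.2 hxρ)]
    nlinarith [pow_nonneg hxρ0 n]
  have hsum : ∑ j ∈ range n, x ^ j * pairsGe d n 0 (j + 1) ≤
      (d : ℝ) ^ (2 * n) * (ρ / (1 - x * ρ)) := by
    calc ∑ j ∈ range n, x ^ j * pairsGe d n 0 (j + 1)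
        ≤ ∑ j ∈ range n, x ^ j * (ρ ^ (j + 1) * (d : ℝ) ^ (2 * n)) :=
          Finset.sum_le_sum fun j _ => mul_le_mul_of_nonneg_left (pairsGe_le hρ0 hρ n (j + 1))
            (pow_nonneg hx0 _)
      _ = (d : ℝ) ^ (2 * n) * (ρ * ∑ j ∈ range n, (x * ρ) ^ j) := by
          rw [Finset.mul_sum, Finset.mul_sum]
          exact Finset.sum_congr rfl fun j _ => by ring
      _ ≤ (d : ℝ) ^ (2 * n) * (ρ / (1 - x * ρ)) := by
          refine mul_le_mul_of_nonneg_left ?_ (by positivity)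
          calc ρ * ∑ j ∈ range n, (x * ρ) ^ j ≤ ρ * (1 / (1 - x * ρ)) :=
                mul_le_mul_of_nonneg_left hgeom hρ0
            _ = ρ / (1 - x * ρ) := by ring
  have hx1' : 0 ≤ x - 1 := sub_nonneg.2 hx1
  calc (d : ℝ) ^ (2 * n) + (x - 1) * ∑ j ∈ range n, x ^ j * pairsGe d n 0 (j + 1)
      ≤ (d : ℝ) ^ (2 * n) + (x - 1) * ((d : ℝ) ^ (2 * n) * (ρ / (1 - x * ρ))) := by
        gcongr
    _ = (d : ℝ) ^ (2 * n) * (p * (1 - ρ) / (p - ρ)) := by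
        have h1 : (1 : ℝ) - p⁻¹ * ρ ≠ 0 := by rw [← hx]; exact (sub_pos.2 hxρ).ne'
        have h2 : p - ρ ≠ 0 := (sub_pos.2 hρp).ne'
        have h3 : p ≠ 0 := hp0.ne'
        rw [hx]
        field_simp
        ring


/-! ### Open oriented paths: the events `A_w` and their probabilities -/

/-- The event "all edges of the oriented path of `w` are open". [cite: CoxDurrett1983, §1] -/
def openOriented {n : ℕ} (w : Fin n → Fin d) : Set (BondConfig (Site d)) :=
  {ω | (↑(oedges w) : Set (Sym2 (Site d))) ⊆ ω}

/-- `A_w` is a (finite-dimensional cylinder, hence) measurable event. [folklore] -/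
theorem measurableSet_openOriented {n : ℕ} (w : Fin n → Fin d) :
    MeasurableSet (openOriented w) :=
  measurableSet_setOf_subset (Finset.countable_toSet _)

/-- `P_p(A_w) = p^n`. [cite: CoxDurrett1983, §3 (3.1)] -/
theorem real_openOriented {n : ℕ} (p : unitInterval) (w : Fin n → Fin d) :
    (bondPercolation (zdGraph d) p).real (openOriented w) = (p : ℝ) ^ n := by
  rw [openOriented, bondPercolation_real_setOf_subset _ p _ (coe_oedges_subset_edgeSet w),
    card_oedges]

/-- `A_w ∩ A_{w'}` is the cylinder event of the union of the two edge sets. [folklore] -/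
theorem openOriented_inter {n : ℕ} (w w' : Fin n → Fin d) :
    openOriented w ∩ openOriented w' =
      {ω | (↑(oedges w ∪ oedges w') : Set (Sym2 (Site d))) ⊆ ω} := by
  ext ω
  simp only [openOriented, Set.mem_inter_iff, Set.mem_setOf_eq, Finset.coe_union,
    Set.union_subset_iff]

/-- `P_p(A_w ∩ A_w') = p^{|E(w) ∪ E(w')|} = p^{2n - #common}`. [cite: CoxDurrett1983, §3 (3.2)] -/
theorem real_openOriented_inter {n : ℕ} (p : unitInterval) (w w' : Fin n → Fin d) :
    (bondPercolation (zdGraph d) p).real (openOriented w ∩ openOriented w') =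
      (p : ℝ) ^ (oedges w ∪ oedges w').card := by
  rw [openOriented_inter, bondPercolation_real_setOf_subset _ p _ ?_]
  rw [Finset.coe_union, Set.union_subset_iff]
  exact ⟨coe_oedges_subset_edgeSet w, coe_oedges_subset_edgeSet w'⟩

/-- The event "some oriented path of length `n` from the origin is open" (`N_n ≥ 1`).
[cite: CoxDurrett1983, §1] -/
def someOpenOriented (d n : ℕ) : Set (BondConfig (Site d)) :=
  ⋃ w : Fin n → Fin d, openOriented w

/-- `{N_n ≥ 1}` is measurable. [folklore] -/
theorem measurableSet_someOpenOriented (d n : ℕ) : MeasurableSet (someOpenOriented d n) :=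
  MeasurableSet.iUnion fun w => measurableSet_openOriented w

/-- The first `n` edges of an `(n+1)`-step oriented path. [folklore] -/
theorem oedges_init_subset {n : ℕ} (w : Fin (n + 1) → Fin d) :
    oedges (Fin.init w) ⊆ oedges w := by
  intro e he
  obtain ⟨k, -, rfl⟩ := Finset.mem_image.1 he
  refine Finset.mem_image.2 ⟨k.castSucc, Finset.mem_univ _, ?_⟩
  show s(opos w k, opos w (k + 1)) = s(opos (Fin.init w) k, opos (Fin.init w) (k + 1))
  rw [opos_init w (Nat.le_of_lt k.2), opos_init w k.2]

/-- The events `{N_n ≥ 1}` decrease in `n` (restrict an open path to its first `n` steps).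
[cite: CoxDurrett1983, §1] -/
theorem someOpenOriented_antitone (d : ℕ) : Antitone (someOpenOriented d) := by
  refine antitone_nat_of_succ_le fun n ω hω => ?_
  obtain ⟨w, hw⟩ := Set.mem_iUnion.1 hω
  exact Set.mem_iUnion.2 ⟨Fin.init w, fun e he => hw (oedges_init_subset w he)⟩

/-- An open oriented path puts its vertices in the open cluster of the origin.
[cite: CoxDurrett1983, §1] -/
theorem reachable_opos_of_subset {n : ℕ} {w : Fin n → Fin d} {ω : BondConfig (Site d)}
    (h : (↑(oedges w) : Set (Sym2 (Site d))) ⊆ ω) {k : ℕ} (hk : k ≤ n) :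
    (openGraph ω).Reachable 0 (opos w k) := by
  induction k with
  | zero => rw [opos_zero]
  | succ k ih =>
    refine (ih (Nat.le_of_succ_le hk)).trans (SimpleGraph.Adj.reachable ?_)
    rw [openGraph_adj]
    refine ⟨h (Finset.mem_coe.2 (Finset.mem_image.2 ⟨⟨k, hk⟩, Finset.mem_univ _, rfl⟩)), ?_⟩
    intro heq
    have := opos_injOn w (Nat.le_of_succ_le hk) hk heq
    omega

/-- If open oriented paths of every length leave the origin, `|C(0)| = ∞` (their endpoints lie at
all levels): "`p_c(d) ≤ p⃗_c(d)`". [cite: BockEtAl2020, §4 (proof of Cor 1.5)] -/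
theorem iInter_someOpenOriented_subset (d : ℕ) :
    (⋂ n, someOpenOriented d n) ⊆ percolatesAt (0 : Site d) := by
  intro ω hω
  simp only [Set.mem_iInter, someOpenOriented, Set.mem_iUnion] at hω
  choose w hw using hω
  refine Set.infinite_of_injective_forall_mem (f := fun n : ℕ => opos (w n) n) ?_ ?_
  · intro m m' h
    have h' : level (opos (w m) m) = level (opos (w m') m') := congrArg level h
    rw [level_opos (w m) le_rfl, level_opos (w m') le_rfl] at h'
    exact_mod_cast h'
  · intro m
    exact reachable_opos_of_subset (hw m) le_rfl

/-! ### The second-moment bound and its consequences -/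

/-- **Cox–Durrett second-moment bound** (finite `n`): if `meetPairs d m ≤ ρ d^{2m}` for all `m`
and `ρ < p`, then `P_p(N_n ≥ 1) ≥ (E N_n)² / E N_n² ≥ (p - ρ)/(p (1 - ρ))`.
[cite: CoxDurrett1983, §3 (3.1)–(3.3)] -/
theorem real_someOpenOriented_ge (hd : 1 ≤ d) {ρ : ℝ} (hρ0 : 0 ≤ ρ)
    (hρ : ∀ m, meetPairs d m ≤ ρ * (d : ℝ) ^ (2 * m)) (p : unitInterval) (hρp : ρ < p) (n : ℕ) :
    ((p : ℝ) - ρ) / (p * (1 - ρ)) ≤ (bondPercolation (zdGraph d) p).real (someOpenOriented d n) := by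
  haveI : Nonempty (Fin d) := ⟨⟨0, hd⟩⟩
  set μ := bondPercolation (zdGraph d) p with hμ
  have hp0 : (0 : ℝ) < p := hρ0.trans_lt hρp
  have hp1 : (p : ℝ) ≤ 1 := p.2.2
  have hρ1 : ρ < 1 := hρp.trans_le hp1
  have hd0 : (d : ℝ) ≠ 0 := by exact_mod_cast (show d ≠ 0 by omega)
  have key := sq_sum_measureReal_div_le_measureReal_biUnion μ (univ : Finset (Fin n → Fin d))
    openOriented (fun w _ => measurableSet_openOriented w)
  have hU : (⋃ w ∈ (univ : Finset (Fin n → Fin d)), openOriented w) = someOpenOriented d n := by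
    simp [someOpenOriented]
  rw [hU] at key
  refine le_trans ?_ key
  have hnum : ∑ w ∈ (univ : Finset (Fin n → Fin d)), μ.real (openOriented w) =
      (d : ℝ) ^ n * (p : ℝ) ^ n := by
    simp only [hμ, real_openOriented, Finset.sum_const, Finset.card_univ, Fintype.card_fun,
      Fintype.card_fin, nsmul_eq_mul]
    push_cast
    ring
  have hden : ∑ w ∈ (univ : Finset (Fin n → Fin d)), ∑ w' ∈ (univ : Finset (Fin n → Fin d)),
      μ.real (openOriented w ∩ openOriented w') =
      (p : ℝ) ^ (2 * n) * ∑ w : Fin n → Fin d, ∑ w' : Fin n → Fin d,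
        (p : ℝ)⁻¹ ^ meetCount 0 w w' := by
    rw [Finset.mul_sum]
    refine Finset.sum_congr rfl fun w _ => ?_
    rw [Finset.mul_sum]
    refine Finset.sum_congr rfl fun w' _ => ?_
    rw [hμ, real_openOriented_inter, ← card_oedges_union_add w w', pow_add, inv_pow, mul_assoc,
      mul_inv_cancel₀ (pow_ne_zero _ hp0.ne'), mul_one]
  rw [hnum, hden]
  have hden_le : (p : ℝ) ^ (2 * n) * ∑ w : Fin n → Fin d, ∑ w' : Fin n → Fin d,
      (p : ℝ)⁻¹ ^ meetCount 0 w w' ≤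
      (p : ℝ) ^ (2 * n) * ((d : ℝ) ^ (2 * n) * (p * (1 - ρ) / (p - ρ))) :=
    mul_le_mul_of_nonneg_left (sum_pow_meetCount_le hρ0 hρ hρp hp1 n) (by positivity)
  have hden_pos : 0 < (p : ℝ) ^ (2 * n) * ∑ w : Fin n → Fin d, ∑ w' : Fin n → Fin d,
      (p : ℝ)⁻¹ ^ meetCount 0 w w' := by
    refine mul_pos (by positivity) (Finset.sum_pos (fun w _ => ?_) Finset.univ_nonempty)
    exact Finset.sum_pos (fun w' _ => by positivity) Finset.univ_nonempty
  calc ((p : ℝ) - ρ) / (p * (1 - ρ))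
      = ((d : ℝ) ^ n * (p : ℝ) ^ n) ^ 2 /
          ((p : ℝ) ^ (2 * n) * ((d : ℝ) ^ (2 * n) * (p * (1 - ρ) / (p - ρ)))) := by
        have h2 : (p : ℝ) - ρ ≠ 0 := (sub_pos.2 hρp).ne'
        have h3 : (1 : ℝ) - ρ ≠ 0 := (sub_pos.2 hρ1).ne'
        field_simp
        ring
    _ ≤ ((d : ℝ) ^ n * (p : ℝ) ^ n) ^ 2 / ((p : ℝ) ^ (2 * n) *
          ∑ w : Fin n → Fin d, ∑ w' : Fin n → Fin d, (p : ℝ)⁻¹ ^ meetCount 0 w w') :=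
        div_le_div_of_nonneg_left (sq_nonneg _) hden_pos hden_le

/-- **`θ_0(p) ≥ (p - ρ)/(p(1 - ρ))` for `p > ρ`** (continuity from above along the decreasing events
`{N_n ≥ 1}`, whose intersection forces `|C(0)| = ∞`). [cite: CoxDurrett1983, §3; BockEtAl2020, §4] -/
theorem theta_zd_ge_of_meetPairs_le (hd : 1 ≤ d) {ρ : ℝ} (hρ0 : 0 ≤ ρ)
    (hρ : ∀ m, meetPairs d m ≤ ρ * (d : ℝ) ^ (2 * m)) (p : unitInterval) (hρp : ρ < p) :
    ((p : ℝ) - ρ) / (p * (1 - ρ)) ≤ theta (zdGraph d) 0 p := by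
  set μ := bondPercolation (zdGraph d) p with hμ
  have h1 : μ (⋂ n, someOpenOriented d n) = ⨅ n, μ (someOpenOriented d n) :=
    (someOpenOriented_antitone d).measure_iInter
      (fun n => (measurableSet_someOpenOriented d n).nullMeasurableSet) ⟨0, measure_ne_top _ _⟩
  have h2 : ENNReal.ofReal (((p : ℝ) - ρ) / (p * (1 - ρ))) ≤ μ (⋂ n, someOpenOriented d n) := by
    rw [h1]
    refine le_iInf fun n => ?_
    rw [← ENNReal.ofReal_toReal (measure_ne_top μ (someOpenOriented d n))]
    exact ENNReal.ofReal_le_ofReal (real_someOpenOriented_ge hd hρ0 hρ p hρp n)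
  have h3 : μ (⋂ n, someOpenOriented d n) ≤ μ (percolatesAt 0) :=
    measure_mono (iInter_someOpenOriented_subset d)
  rw [theta, measureReal_def]
  exact (ENNReal.ofReal_le_iff_le_toReal (measure_ne_top _ _)).1 (h2.trans h3)

/-- **Cox–Durrett (1983), as used in BDNS (2020) §4: `p_c(ℤ^d) ≤ ρ_d`.**  If the probability that
two independent uniform oriented `m`-step walks from the origin share a step is at most `ρ` for
every `m` (`meetPairs d m ≤ ρ d^{2m}`; e.g. `ρ = ρ_d = sup_m meetPairs d m / d^{2m}`), then
`θ_0(p) > 0` for every `p > ρ`, hence `p_c(d) ≤ p⃗_c(d) ≤ ρ`.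
[cite: CoxDurrett1983, §1; BockEtAl2020, §4 (proof of Cor 1.5)] -/
theorem criticalProb_zd_le_of_meetPairs_le (hd : 1 ≤ d) {ρ : ℝ} (hρ0 : 0 ≤ ρ)
    (hρ : ∀ m, meetPairs d m ≤ ρ * (d : ℝ) ^ (2 * m)) : criticalProb (zdGraph d) 0 ≤ ρ := by
  refine le_of_forall_gt_imp_ge_of_dense fun q hq => ?_
  rcases le_or_gt q 1 with hq1 | hq1
  · have hq0 : 0 ≤ q := hρ0.trans hq.le
    have hρ1 : ρ < 1 := hq.trans_le hq1
    have hpos : 0 < (q - ρ) / (q * (1 - ρ)) :=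
      div_pos (sub_pos.2 hq) (mul_pos (hρ0.trans_lt hq) (sub_pos.2 hρ1))
    have hθ : 0 < theta (zdGraph d) 0 ⟨q, hq0, hq1⟩ :=
      hpos.trans_le (theta_zd_ge_of_meetPairs_le hd hρ0 hρ ⟨q, hq0, hq1⟩ hq)
    refine csInf_le ⟨0, ?_⟩ (Or.inl ⟨⟨hq0, hq1⟩, hθ⟩)
    rintro r (⟨hr, -⟩ | hr)
    · exact hr.1
    · rw [Set.mem_singleton_iff] at hr
      rw [hr]
      exact zero_le_one
  · exact (criticalProb_mem_Icc _ _).2.trans hq1.le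

/-- The meeting probabilities are at most `1`, so the hypothesis is never vacuous (`ρ = 1` gives the
trivial bound `p_c ≤ 1`). [folklore] -/
example (hd : 1 ≤ d) : criticalProb (zdGraph d) 0 ≤ 1 :=
  criticalProb_zd_le_of_meetPairs_le hd zero_le_one fun m => by simpa using meetPairs_le d m

end Literature.Probability.Percolation

end
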